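import Summits.Ventures.PercRepro.C026ProdCSMain

/-!
# THEOREM PROD ((CS) composition) in the count form (p5, gen 16)

mine-3's THEOREM PROD (`proofs/MINE3-PRODUCT.md` §0–§1) as stated: for (unnormalized) generators
`gᵢ = (zᵢ, pᵢ, qᵢ, nᵢ, Aᵢ, Bᵢ) ∈ K` — nonnegative, `p ≤ A`, `q ≤ B` (C1), `n² ≤ AB` (C3),
`(n + p)² ≤ At`, `(n + q)² ≤ Bt` (C4), `t = z + p + q + n` — with `T = Π tᵢ`, `P = Π (zᵢ + pᵢ)`,
`Q = Π (zᵢ + qᵢ)`, `Z = Π zᵢ`, `Mₐ = Π (tᵢ + Aᵢ)`, `M_b = Π (tᵢ + Bᵢ)`: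
`(T − P − Q + Z)² ≤ (Mₐ − T)(M_b − T)`, i.e. `N² ≤ 𝒜ℬ`. Step 0 of the paper: every coordinate
is homogeneous of degree one in each generator, so a generator with `t = 0` contributes `N = 0`
and the others normalize to `t = 1` (`GenC.normalize`, `memK_normalize`), where `prod_cs` applies.

* `GenC`, `MemKC` — the count generators and the cone `K`;
* `GenC.normalize`, `memK_normalize` — normalization to `t = 1`;
* **`prod_cs_counts`** — THEOREM PROD in the count form.
-/

namespace PercRepro

namespace ProdCS

open Finset

/-- A count generator `(z, p, q, n, A, B)`. -/
structure GenC where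
  /-- no bit -/
  z : ℝ
  /-- `a`-bit only -/
  p : ℝ
  /-- `b`-bit only -/
  q : ℝ
  /-- both bits -/
  n : ℝ
  /-- the cell `ac|b` -/
  A : ℝ
  /-- the cell `bc|a` -/
  B : ℝ

namespace GenC

/-- `t = z + p + q + n`, the total. -/
def t (g : GenC) : ℝ := g.z + g.p + g.q + g.n

/-- **The cone `K`** in the count form: nonnegativity, (C1) `p ≤ A`, `q ≤ B`, (C3) `n² ≤ AB`,
(C4) `(n + p)² ≤ At`, `(n + q)² ≤ Bt`. -/
structure MemKC (g : GenC) : Prop where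
  /-- `0 ≤ z` -/
  z_nonneg : 0 ≤ g.z
  /-- `0 ≤ p` -/
  p_nonneg : 0 ≤ g.p
  /-- `0 ≤ q` -/
  q_nonneg : 0 ≤ g.q
  /-- `0 ≤ n` -/
  n_nonneg : 0 ≤ g.n
  /-- `0 ≤ A` -/
  A_nonneg : 0 ≤ g.A
  /-- `0 ≤ B` -/
  B_nonneg : 0 ≤ g.B
  /-- (C1) -/
  p_le : g.p ≤ g.A
  /-- (C1) -/
  q_le : g.q ≤ g.B
  /-- (C3) -/
  c3 : g.n ^ 2 ≤ g.A * g.B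
  /-- (C4) -/
  c4a : (g.n + g.p) ^ 2 ≤ g.A * g.t
  /-- (C4) -/
  c4b : (g.n + g.q) ^ 2 ≤ g.B * g.t

/-- The normalization `g / t`. -/
noncomputable def normalize (g : GenC) : Gen :=
  ⟨g.z / g.t, g.p / g.t, g.q / g.t, g.n / g.t, g.A / g.t, g.B / g.t⟩

/-- A count generator of `K` with `t > 0` normalizes into the normalized cone. -/
theorem memK_normalize {g : GenC} (h : MemKC g) (ht : 0 < g.t) : Gen.MemK g.normalize := by
  have ht2 : 0 < g.t ^ 2 := by positivity
  refine ⟨div_nonneg h.z_nonneg ht.le, div_nonneg h.p_nonneg ht.le, div_nonneg h.q_nonneg ht.le,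
    div_nonneg h.n_nonneg ht.le, div_nonneg h.A_nonneg ht.le, div_nonneg h.B_nonneg ht.le, ?_,
    div_le_div_of_nonneg_right h.p_le ht.le, div_le_div_of_nonneg_right h.q_le ht.le, ?_, ?_, ?_⟩
  · show g.z / g.t + g.p / g.t + g.q / g.t + g.n / g.t = 1
    rw [← add_div, ← add_div, ← add_div]
    exact div_self ht.ne'
  · show (g.n / g.t) ^ 2 ≤ g.A / g.t * (g.B / g.t)
    rw [div_pow, div_mul_div_comm, div_le_div_iff₀ ht2 (by positivity)]
    calc g.n ^ 2 * (g.t * g.t) ≤ g.A * g.B * (g.t * g.t) :=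
          mul_le_mul_of_nonneg_right h.c3 (by positivity)
      _ = g.A * g.B * g.t ^ 2 := by ring
  · show (g.p / g.t + g.n / g.t) ^ 2 ≤ g.A / g.t
    rw [← add_div, div_pow, div_le_div_iff₀ ht2 ht, add_comm]
    calc (g.n + g.p) ^ 2 * g.t ≤ g.A * g.t * g.t := mul_le_mul_of_nonneg_right h.c4a ht.le
      _ = g.A * g.t ^ 2 := by ring
  · show (g.q / g.t + g.n / g.t) ^ 2 ≤ g.B / g.t
    rw [← add_div, div_pow, div_le_div_iff₀ ht2 ht, add_comm]
    calc (g.n + g.q) ^ 2 * g.t ≤ g.B * g.t * g.t := mul_le_mul_of_nonneg_right h.c4b ht.le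
      _ = g.B * g.t ^ 2 := by ring

end GenC

open GenC

variable {ι : Type*} [DecidableEq ι]

/-- **THEOREM PROD in the count form** (mine-3, `MINE3-PRODUCT.md` §1): for a finite family of
count generators in `K`, `(T − P − Q + Z)² ≤ (Mₐ − T)(M_b − T)` — `N² ≤ 𝒜ℬ` with
`T = Π tᵢ`, `P = Π (zᵢ + pᵢ)`, `Q = Π (zᵢ + qᵢ)`, `Z = Π zᵢ`, `Mₐ = Π (tᵢ + Aᵢ)`, `M_b = Π (tᵢ + Bᵢ)`. -/
theorem prod_cs_counts (s : Finset ι) (g : ι → GenC) (hK : ∀ i ∈ s, MemKC (g i)) :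
    (∏ i ∈ s, (g i).t - ∏ i ∈ s, ((g i).z + (g i).p) - ∏ i ∈ s, ((g i).z + (g i).q) +
        ∏ i ∈ s, (g i).z) ^ 2 ≤
      (∏ i ∈ s, ((g i).t + (g i).A) - ∏ i ∈ s, (g i).t) *
        (∏ i ∈ s, ((g i).t + (g i).B) - ∏ i ∈ s, (g i).t) := by
  have ht0 : ∀ i ∈ s, 0 ≤ (g i).t := fun i hi => by
    have h := hK i hi; unfold GenC.t
    linarith [h.z_nonneg, h.p_nonneg, h.q_nonneg, h.n_nonneg]
  by_cases hz : ∃ i ∈ s, (g i).t = 0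
  · -- a generator with `t = 0`: `T = P = Q = Z = 0`
    obtain ⟨i, hi, hti⟩ := hz
    have h := hK i hi
    have hz0 : (g i).z = 0 := by unfold GenC.t at hti; linarith [h.z_nonneg, h.p_nonneg, h.q_nonneg, h.n_nonneg]
    have hp0 : (g i).p = 0 := by unfold GenC.t at hti; linarith [h.z_nonneg, h.p_nonneg, h.q_nonneg, h.n_nonneg]
    have hq0 : (g i).q = 0 := by unfold GenC.t at hti; linarith [h.z_nonneg, h.p_nonneg, h.q_nonneg, h.n_nonneg]
    have hT : ∏ j ∈ s, (g j).t = 0 := Finset.prod_eq_zero hi hti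
    have hP : ∏ j ∈ s, ((g j).z + (g j).p) = 0 := Finset.prod_eq_zero hi (by rw [hz0, hp0]; ring)
    have hQ : ∏ j ∈ s, ((g j).z + (g j).q) = 0 := Finset.prod_eq_zero hi (by rw [hz0, hq0]; ring)
    have hZ : ∏ j ∈ s, (g j).z = 0 := Finset.prod_eq_zero hi hz0
    rw [hT, hP, hQ, hZ]
    have hMa : 0 ≤ ∏ j ∈ s, ((g j).t + (g j).A) :=
      Finset.prod_nonneg fun j hj => by linarith [ht0 j hj, (hK j hj).A_nonneg]
    have hMb : 0 ≤ ∏ j ∈ s, ((g j).t + (g j).B) :=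
      Finset.prod_nonneg fun j hj => by linarith [ht0 j hj, (hK j hj).B_nonneg]
    nlinarith [mul_nonneg hMa hMb]
  · -- every `t > 0`: normalize and apply `prod_cs`
    push Not at hz
    have htpos : ∀ i ∈ s, 0 < (g i).t := fun i hi => lt_of_le_of_ne (ht0 i hi) (Ne.symm (hz i hi))
    have hT : 0 < ∏ i ∈ s, (g i).t := Finset.prod_pos htpos
    have key := prod_cs s (fun i => (g i).normalize) fun i hi => memK_normalize (hK i hi) (htpos i hi)
    unfold CS N calA calB at key
    -- the normalized products are the count products over `T`
    have e1 : ∏ i ∈ s, (1 - ((g i).normalize).v) = (∏ i ∈ s, ((g i).z + (g i).p)) / ∏ i ∈ s, (g i).t := by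
      rw [← Finset.prod_div_distrib]
      refine Finset.prod_congr rfl fun i hi => ?_
      have := htpos i hi
      simp only [GenC.normalize, Gen.v]
      field_simp
      unfold GenC.t; ring
    have e2 : ∏ i ∈ s, (1 - ((g i).normalize).u) = (∏ i ∈ s, ((g i).z + (g i).q)) / ∏ i ∈ s, (g i).t := by
      rw [← Finset.prod_div_distrib]
      refine Finset.prod_congr rfl fun i hi => ?_
      have := htpos i hi
      simp only [GenC.normalize, Gen.u]
      field_simp
      unfold GenC.t; ring
    have e3 : ∏ i ∈ s, ((g i).normalize).ζ = (∏ i ∈ s, (g i).z) / ∏ i ∈ s, (g i).t := by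
      rw [← Finset.prod_div_distrib]
      rfl
    have e4 : ∏ i ∈ s, (1 + ((g i).normalize).α) =
        (∏ i ∈ s, ((g i).t + (g i).A)) / ∏ i ∈ s, (g i).t := by
      rw [← Finset.prod_div_distrib]
      refine Finset.prod_congr rfl fun i hi => ?_
      have := htpos i hi
      simp only [GenC.normalize]
      field_simp
    have e5 : ∏ i ∈ s, (1 + ((g i).normalize).β) =
        (∏ i ∈ s, ((g i).t + (g i).B)) / ∏ i ∈ s, (g i).t := by
      rw [← Finset.prod_div_distrib]
      refine Finset.prod_congr rfl fun i hi => ?_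
      have := htpos i hi
      simp only [GenC.normalize]
      field_simp
    rw [e1, e2, e3, e4, e5] at key
    set T := ∏ i ∈ s, (g i).t with hTdef
    set P := ∏ i ∈ s, ((g i).z + (g i).p)
    set Q := ∏ i ∈ s, ((g i).z + (g i).q)
    set Z := ∏ i ∈ s, (g i).z
    set Ma := ∏ i ∈ s, ((g i).t + (g i).A)
    set Mb := ∏ i ∈ s, ((g i).t + (g i).B)
    have hne : T ≠ 0 := hT.ne'
    have key' : ((T - P - Q + Z) / T) ^ 2 ≤ ((Ma - T) / T) * ((Mb - T) / T) := by
      have h1 : 1 - P / T - Q / T + Z / T = (T - P - Q + Z) / T := by field_simp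
      have h2 : Ma / T - 1 = (Ma - T) / T := by field_simp
      have h3 : Mb / T - 1 = (Mb - T) / T := by field_simp
      rw [h1, h2, h3] at key
      exact key
    rw [div_pow, div_mul_div_comm, div_le_div_iff₀ (by positivity) (by positivity)] at key'
    have hT2 : 0 < T ^ 2 := by positivity
    nlinarith [key', hT2]

end ProdCS

end PercRepro
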